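import Summits.ValiantsHypothesis.ValiantsHypothesis.Theorems.BarrierLeverPartitionMinorsHitByVPMooreBall

/-!
# Route BarrierLever — item `PartitionMinorsHitByVP` (stmt-ValiantsHypothesis-19717):
# the characteristic-2 Moore table is NOT universal — `¬ MooreBallNonsingular 5 2` in the kernel

Helper file (`--supports stmt-ValiantsHypothesis-19717`; cell valiant-natproofs, rung V4, 𝒟-side door (c),
prover seat val-np-p6 gen 5). Closes NO item. A located NEGATIVE for the characteristic-2 Frobenius door
(`…HitByVPFrobeniusDoor`, `…HitByVPMooreBall`): the predicate `MooreBallNonsingular 5 2` («for rows = the Hamming ball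
`B([5],2)` every injective column family has a nonzero characteristic-2 generalized Vandermonde») is FALSE.

WITNESS (first of the 358 failures of kit census j281989): columns with binary weights `8,…,21,24,25`. MECHANISM: for the
sixteen nodes `η_S = Y₀ + Σ_{k∈S} Y_k`, `|S| ≤ 2`, `S ⊆ [5]`, one has in `𝔽₂[Y]` (Newton's identities over `ℤ`, then reduction)
`e₁ = s`, `e₂ = Y₀ s`, `e₃ = Y₀² s` with `s = Y₁ + ⋯ + Y₅`; hence the polynomial `f = X^8 (X + Y₀) ∏_S (X + η_S)` of degree `25`
has vanishing coefficients at `X^22`, `X^23` (`e₃ + Y₀e₂ = 0`, `e₂ + Y₀e₁ = 0`) and at `X^0..X^7`, so its coefficient vector on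
the sixteen exponents `8..21, 24, 25` is a nonzero (leading coefficient `1`) null vector of the generalized Vandermonde
`[η_S^m]`: `Σ_m coeff_m(f) η_S^m = f(η_S) = 0`.

* `rows52`, `cols52` — the layout; `not_mooreBallNonsingular_five_two : ¬ MooreBallNonsingular 5 2`.

The characteristic-3 table certifies the same layout (kit j282889: characteristic 3 has no failure among all 601 080 390
column families at `(5,2)`), so this is a statement about the door, not about item 19717 or conjecture T1. WHAT THIS IS NOT:
nothing on T1, F_3, CPM, crux 14610 or VP vs VNP.
-/

set_option linter.dupNamespace false

namespace Summit.ValiantsHypothesis.ValiantsHypothesis.Theorems.BarrierLever.FrobeniusDoor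

open Finset MvPolynomial Matrix

noncomputable section

/-! ## 1. The layout -/

/-- Rows: the Hamming ball `B([5], 2)` — `∅`, the five singletons, the ten pairs. -/
def rows52 : Fin 16 → Finset (Fin 5) :=
  ![∅, {0}, {1}, {2}, {3}, {4}, {0, 1}, {0, 2}, {0, 3}, {0, 4}, {1, 2}, {1, 3}, {1, 4}, {2, 3}, {2, 4}, {3, 4}]

/-- Columns: the subsets of `Fin 5` with binary weights `8, 9, …, 21, 24, 25`. -/
def cols52 : Fin 16 → Finset (Fin 5) :=
  ![{3}, {0, 3}, {1, 3}, {0, 1, 3}, {2, 3}, {0, 2, 3}, {1, 2, 3}, {0, 1, 2, 3}, {4}, {0, 4}, {1, 4}, {0, 1, 4}, {2, 4},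
    {0, 2, 4}, {3, 4}, {0, 3, 4}]

/-- The binary weights of the columns. -/
def wt52 : Fin 16 → ℕ := ![8, 9, 10, 11, 12, 13, 14, 15, 16, 17, 18, 19, 20, 21, 24, 25]

/-- The binary weights of `cols52` are `wt52`. -/
theorem cols52_wt (j : Fin 16) : ∑ c ∈ cols52 j, 2 ^ (c : ℕ) = wt52 j := by revert j; decide

/-! ## 2. Power sums and the first three elementary symmetric functions of the sixteen nodes -/

/-- The nodes over `ℤ`: `η_i = Y_none + Σ_{a ∈ rows52 i} Y_(some a)`. -/
def nodeZ (i : Fin 16) : MvPolynomial (Option (Fin 5)) ℤ := X none + ∑ a ∈ rows52 i, X (some a)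

/-- The nodes over `𝔽₂`. -/
def node (i : Fin 16) : MvPolynomial (Option (Fin 5)) (ZMod 2) := X none + ∑ a ∈ rows52 i, X (some a)

/-- Reduction modulo `2` of the integer nodes. -/
theorem map_nodeZ (i : Fin 16) : MvPolynomial.map (Int.castRingHom (ZMod 2)) (nodeZ i) = node i := by
  simp [nodeZ, node, map_X]

/-- `s₁ = Y₁ + ⋯ + Y₅` (over `ℤ`). -/
def s1Z : MvPolynomial (Option (Fin 5)) ℤ := X (some 0) + X (some 1) + X (some 2) + X (some 3) + X (some 4)
/-- `s₂ = Σ Y_a²` (over `ℤ`). -/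
def s2Z : MvPolynomial (Option (Fin 5)) ℤ :=
  X (some 0) ^ 2 + X (some 1) ^ 2 + X (some 2) ^ 2 + X (some 3) ^ 2 + X (some 4) ^ 2
/-- `s₃ = Σ Y_a³` (over `ℤ`). -/
def s3Z : MvPolynomial (Option (Fin 5)) ℤ :=
  X (some 0) ^ 3 + X (some 1) ^ 3 + X (some 2) ^ 3 + X (some 3) ^ 3 + X (some 4) ^ 3
/-- `q₂ = Σ_{a<b} Y_a Y_b` (over `ℤ`). -/
def q2Z : MvPolynomial (Option (Fin 5)) ℤ :=
  X (some 0) * X (some 1) + X (some 0) * X (some 2) + X (some 0) * X (some 3) + X (some 0) * X (some 4) + X (some 1) * X (some 2) + X (some 1) * X (some 3) + X (some 1) * X (some 4) + X (some 2) * X (some 3) + X (some 2) * X (some 4) + X (some 3) * X (some 4)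
/-- `q₂₁ = Σ_{a ≠ b} Y_a² Y_b` (over `ℤ`). -/
def q21Z : MvPolynomial (Option (Fin 5)) ℤ :=
  X (some 0) ^ 2 * X (some 1) + X (some 0) ^ 2 * X (some 2) + X (some 0) ^ 2 * X (some 3) + X (some 0) ^ 2 * X (some 4) +
  X (some 1) ^ 2 * X (some 0) + X (some 1) ^ 2 * X (some 2) + X (some 1) ^ 2 * X (some 3) + X (some 1) ^ 2 * X (some 4) +
  X (some 2) ^ 2 * X (some 0) + X (some 2) ^ 2 * X (some 1) + X (some 2) ^ 2 * X (some 3) + X (some 2) ^ 2 * X (some 4) +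
  X (some 3) ^ 2 * X (some 0) + X (some 3) ^ 2 * X (some 1) + X (some 3) ^ 2 * X (some 2) + X (some 3) ^ 2 * X (some 4) +
  X (some 4) ^ 2 * X (some 0) + X (some 4) ^ 2 * X (some 1) + X (some 4) ^ 2 * X (some 2) + X (some 4) ^ 2 * X (some 3)
/-- `q₃ = Σ_{a<b<c} Y_a Y_b Y_c` (over `ℤ`). -/
def q3Z : MvPolynomial (Option (Fin 5)) ℤ :=
  X (some 0) * X (some 1) * X (some 2) + X (some 0) * X (some 1) * X (some 3) + X (some 0) * X (some 1) * X (some 4) + X (some 0) * X (some 2) * X (some 3) + X (some 0) * X (some 2) * X (some 4) + X (some 0) * X (some 3) * X (some 4) +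
  X (some 1) * X (some 2) * X (some 3) + X (some 1) * X (some 2) * X (some 4) + X (some 1) * X (some 3) * X (some 4) +
  X (some 2) * X (some 3) * X (some 4)

/-- Power sums: `p₁ = 16 Y₀ + 5 s₁`. -/
theorem psum1 : ∑ i : Fin 16, nodeZ i = 16 * X none + 5 * s1Z := by
  simp only [nodeZ, rows52, s1Z, Fin.sum_univ_succ, Fin.sum_univ_zero]
  simp
  ring

/-- `p₂ = 16 Y₀² + 10 Y₀ s₁ + 5 s₂ + 2 q₂`. -/
theorem psum2 : ∑ i : Fin 16, nodeZ i ^ 2 = 16 * X none ^ 2 + 10 * X none * s1Z + 5 * s2Z + 2 * q2Z := by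
  simp only [nodeZ, rows52, s1Z, s2Z, q2Z, Fin.sum_univ_succ, Fin.sum_univ_zero]
  simp
  ring

/-- `p₃ = 16 Y₀³ + 15 Y₀² s₁ + 15 Y₀ s₂ + 6 Y₀ q₂ + 5 s₃ + 3 q₂₁`. -/
theorem psum3 : ∑ i : Fin 16, nodeZ i ^ 3 =
    16 * X none ^ 3 + 15 * X none ^ 2 * s1Z + 15 * X none * s2Z + 6 * X none * q2Z + 5 * s3Z + 3 * q21Z := by
  simp only [nodeZ, rows52, s1Z, s2Z, s3Z, q2Z, q21Z, Fin.sum_univ_succ, Fin.sum_univ_zero]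
  simp
  ring

/-! ## 3. Newton's identities for the nodes and the closed forms of `e₁, e₂, e₃` -/

/-- `E_k = e_k(η)` over `ℤ`: the sum over `k`-subsets of products of nodes. -/
def EZ (k : ℕ) : MvPolynomial (Option (Fin 5)) ℤ :=
  ∑ t ∈ (univ : Finset (Fin 16)).powersetCard k, ∏ i ∈ t, nodeZ i

/-- `aeval nodeZ` sends the generic `esymm` to `E_k`. -/
theorem aeval_esymm_nodeZ (k : ℕ) : aeval nodeZ (MvPolynomial.esymm (Fin 16) ℤ k) = EZ k := by
  rw [aeval_esymm_eq_multiset_esymm, Finset.esymm_map_val]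
  rfl

/-- The same in `bind₁` form (simp normal form). -/
theorem bind_esymm_nodeZ (k : ℕ) : bind₁ nodeZ (MvPolynomial.esymm (Fin 16) ℤ k) = EZ k :=
  aeval_esymm_nodeZ k

/-- `aeval nodeZ` sends the generic power sum to `p_m`. -/
theorem aeval_psum_nodeZ (m : ℕ) : aeval nodeZ (MvPolynomial.psum (Fin 16) ℤ m) = ∑ i, nodeZ i ^ m := by
  simp [MvPolynomial.psum, map_sum, map_pow]

/-- The same in `bind₁` form. -/
theorem bind_psum_nodeZ (m : ℕ) : bind₁ nodeZ (MvPolynomial.psum (Fin 16) ℤ m) = ∑ i, nodeZ i ^ m :=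
  aeval_psum_nodeZ m

/-- `e₁ = p₁`. -/
theorem newton1 : EZ 1 = ∑ i, nodeZ i := by
  rw [← aeval_esymm_nodeZ, MvPolynomial.esymm_one, map_sum]
  simp

/-- Newton, `k = 2`: `2 e₂ = e₁ p₁ − p₂`. -/
theorem newton2 : 2 * EZ 2 = (∑ i, nodeZ i) * (∑ i, nodeZ i) - ∑ i, nodeZ i ^ 2 := by
  have h := congrArg (aeval nodeZ) (MvPolynomial.mul_esymm_eq_sum (Fin 16) ℤ 2)
  simp only [Finset.sum_filter, Finset.Nat.sum_antidiagonal_succ, Finset.Nat.antidiagonal_zero,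
    Finset.sum_singleton, map_mul, map_pow, map_neg, map_one, map_natCast, MvPolynomial.esymm_zero] at h
  norm_num at h
  try simp only [bind_esymm_nodeZ, bind_psum_nodeZ] at h
  linear_combination h

/-- Newton, `k = 3`: `3 e₃ = p₃ − e₁ p₂ + e₂ p₁`. -/
theorem newton3 : 3 * EZ 3 = ∑ i, nodeZ i ^ 3 - (∑ i, nodeZ i) * (∑ i, nodeZ i ^ 2) + EZ 2 * (∑ i, nodeZ i) := by
  have h := congrArg (aeval nodeZ) (MvPolynomial.mul_esymm_eq_sum (Fin 16) ℤ 3)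
  simp only [Finset.sum_filter, Finset.Nat.sum_antidiagonal_succ, Finset.Nat.antidiagonal_zero,
    Finset.sum_singleton, map_mul, map_pow, map_neg, map_one, map_natCast, MvPolynomial.esymm_zero] at h
  norm_num at h
  try simp only [bind_esymm_nodeZ, bind_psum_nodeZ] at h
  linear_combination h

/-- `e₁ = 16 Y₀ + 5 s₁`. -/
theorem EZ_one : EZ 1 = 16 * X none + 5 * s1Z := by rw [newton1, psum1]

/-- `e₂ = 120 Y₀² + 75 Y₀ s₁ + 10 s₂ + 24 q₂`. -/
theorem EZ_two : EZ 2 = 120 * X none ^ 2 + 75 * X none * s1Z + 10 * s2Z + 24 * q2Z := by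
  have h := newton2
  rw [psum1, psum2] at h
  have h2 : (2 : MvPolynomial (Option (Fin 5)) ℤ) * EZ 2 =
      2 * (120 * X none ^ 2 + 75 * X none * s1Z + 10 * s2Z + 24 * q2Z) := by
    rw [h]; simp only [s1Z, s2Z, q2Z]; ring
  have h2ne : (2 : MvPolynomial (Option (Fin 5)) ℤ) ≠ 0 := by
    rw [← map_ofNat C 2, Ne, C_eq_zero]; norm_num
  exact mul_left_cancel₀ h2ne h2

/-- `e₃ = 560 Y₀³ + 525 Y₀² s₁ + 140 Y₀ s₂ + 336 Y₀ q₂ + 10 s₃ + 46 q₂₁ + 110 q₃`. -/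
theorem EZ_three : EZ 3 = 560 * X none ^ 3 + 525 * X none ^ 2 * s1Z + 140 * X none * s2Z + 336 * X none * q2Z +
    10 * s3Z + 46 * q21Z + 110 * q3Z := by
  have h := newton3
  rw [EZ_two, psum1, psum2, psum3] at h
  have h3 : (3 : MvPolynomial (Option (Fin 5)) ℤ) * EZ 3 =
      3 * (560 * X none ^ 3 + 525 * X none ^ 2 * s1Z + 140 * X none * s2Z + 336 * X none * q2Z +
        10 * s3Z + 46 * q21Z + 110 * q3Z) := by
    rw [h]; simp only [s1Z, s2Z, s3Z, q2Z, q21Z, q3Z]; ring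
  have h3ne : (3 : MvPolynomial (Option (Fin 5)) ℤ) ≠ 0 := by
    rw [← map_ofNat C 3, Ne, C_eq_zero]; norm_num
  exact mul_left_cancel₀ h3ne h3

/-! ## 4. Reduction modulo 2: `e₁ = s`, `e₂ = Y₀ s`, `e₃ = Y₀² s` -/

/-- `E_k = e_k(η)` over `𝔽₂`. -/
def Emod (k : ℕ) : MvPolynomial (Option (Fin 5)) (ZMod 2) :=
  ∑ t ∈ (univ : Finset (Fin 16)).powersetCard k, ∏ i ∈ t, node i

/-- `s = Y₁ + ⋯ + Y₅` over `𝔽₂`. -/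
def sbar : MvPolynomial (Option (Fin 5)) (ZMod 2) := X (some 0) + X (some 1) + X (some 2) + X (some 3) + X (some 4)

/-- Reduction modulo `2` of `E_k`. -/
theorem map_EZ (k : ℕ) : MvPolynomial.map (Int.castRingHom (ZMod 2)) (EZ k) = Emod k := by
  simp [EZ, Emod, map_sum, map_prod, map_nodeZ]

/-- `2 = 0` in `𝔽₂[Y]`. -/
theorem two_eq_zero_R2 : (2 : MvPolynomial (Option (Fin 5)) (ZMod 2)) = 0 := by
  have := CharP.cast_eq_zero (MvPolynomial (Option (Fin 5)) (ZMod 2)) 2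
  simpa using this

/-- `e₁ = s` modulo `2`. -/
theorem Emod_one : Emod 1 = sbar := by
  rw [← map_EZ, EZ_one]
  simp only [s1Z, sbar, map_add, map_mul, map_ofNat, map_X]
  linear_combination (8 * X none + 2 * (X (some 0) + X (some 1) + X (some 2) + X (some 3) + X (some 4) :
    MvPolynomial (Option (Fin 5)) (ZMod 2))) * two_eq_zero_R2

/-- `e₂ = Y₀ s` modulo `2`. -/
theorem Emod_two : Emod 2 = X none * sbar := by
  rw [← map_EZ, EZ_two]
  simp only [s1Z, s2Z, q2Z, sbar, map_add, map_mul, map_ofNat, map_pow, map_X]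
  linear_combination (60 * X none ^ 2 + 37 * X none * (X (some 0) + X (some 1) + X (some 2) + X (some 3) + X (some 4))
    + 5 * (X (some 0) ^ 2 + X (some 1) ^ 2 + X (some 2) ^ 2 + X (some 3) ^ 2 + X (some 4) ^ 2)
    + 12 * (X (some 0) * X (some 1) + X (some 0) * X (some 2) + X (some 0) * X (some 3) + X (some 0) * X (some 4)
      + X (some 1) * X (some 2) + X (some 1) * X (some 3) + X (some 1) * X (some 4) + X (some 2) * X (some 3)
      + X (some 2) * X (some 4) + X (some 3) * X (some 4)) : MvPolynomial (Option (Fin 5)) (ZMod 2)) * two_eq_zero_R2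

set_option maxHeartbeats 400000 in
/-- `e₃ = Y₀² s` modulo `2`. -/
theorem Emod_three : Emod 3 = X none ^ 2 * sbar := by
  rw [← map_EZ, EZ_three]
  simp only [s1Z, s2Z, s3Z, q2Z, q21Z, q3Z, sbar, map_add, map_mul, map_ofNat, map_pow, map_X]
  linear_combination (280 * X none ^ 3
    + 262 * X none ^ 2 * (X (some 0) + X (some 1) + X (some 2) + X (some 3) + X (some 4))
    + 70 * X none * (X (some 0) ^ 2 + X (some 1) ^ 2 + X (some 2) ^ 2 + X (some 3) ^ 2 + X (some 4) ^ 2)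
    + 168 * X none * (X (some 0) * X (some 1) + X (some 0) * X (some 2) + X (some 0) * X (some 3)
      + X (some 0) * X (some 4) + X (some 1) * X (some 2) + X (some 1) * X (some 3) + X (some 1) * X (some 4)
      + X (some 2) * X (some 3) + X (some 2) * X (some 4) + X (some 3) * X (some 4))
    + 5 * (X (some 0) ^ 3 + X (some 1) ^ 3 + X (some 2) ^ 3 + X (some 3) ^ 3 + X (some 4) ^ 3)
    + 23 * (X (some 0) ^ 2 * X (some 1) + X (some 0) ^ 2 * X (some 2) + X (some 0) ^ 2 * X (some 3)
      + X (some 0) ^ 2 * X (some 4) + X (some 1) ^ 2 * X (some 0) + X (some 1) ^ 2 * X (some 2)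
      + X (some 1) ^ 2 * X (some 3) + X (some 1) ^ 2 * X (some 4) + X (some 2) ^ 2 * X (some 0)
      + X (some 2) ^ 2 * X (some 1) + X (some 2) ^ 2 * X (some 3) + X (some 2) ^ 2 * X (some 4)
      + X (some 3) ^ 2 * X (some 0) + X (some 3) ^ 2 * X (some 1) + X (some 3) ^ 2 * X (some 2)
      + X (some 3) ^ 2 * X (some 4) + X (some 4) ^ 2 * X (some 0) + X (some 4) ^ 2 * X (some 1)
      + X (some 4) ^ 2 * X (some 2) + X (some 4) ^ 2 * X (some 3))
    + 55 * (X (some 0) * X (some 1) * X (some 2) + X (some 0) * X (some 1) * X (some 3)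
      + X (some 0) * X (some 1) * X (some 4) + X (some 0) * X (some 2) * X (some 3)
      + X (some 0) * X (some 2) * X (some 4) + X (some 0) * X (some 3) * X (some 4)
      + X (some 1) * X (some 2) * X (some 3) + X (some 1) * X (some 2) * X (some 4)
      + X (some 1) * X (some 3) * X (some 4) + X (some 2) * X (some 3) * X (some 4))
    : MvPolynomial (Option (Fin 5)) (ZMod 2)) * two_eq_zero_R2

/-- `e₀ = 1`. -/
theorem Emod_zero : Emod 0 = 1 := by simp [Emod, Finset.powersetCard_zero]

/-! ## 5. The sparse multiple `f = X^8 (X + Y₀) ∏_S (X + η_S)` and the null vector -/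

open Polynomial in
/-- `Π(X) = ∏_i (X + η_i)` over `𝔽₂[Y]`. -/
def PiP : Polynomial (MvPolynomial (Option (Fin 5)) (ZMod 2)) :=
  ∏ i : Fin 16, (Polynomial.X + Polynomial.C (node i))

open Polynomial in
/-- `f(X) = X^8 · (X + Y₀) · Π(X)`. -/
def fP : Polynomial (MvPolynomial (Option (Fin 5)) (ZMod 2)) :=
  Polynomial.X ^ 8 * ((Polynomial.X + Polynomial.C (X none)) * PiP)

open Polynomial in
/-- Vieta: the coefficients of `Π` are the `e_k`. -/
theorem coeff_PiP {k : ℕ} (hk : k ≤ 16) : PiP.coeff k = Emod (16 - k) := by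
  rw [PiP, Finset.prod_X_add_C_coeff univ node (by simpa using hk)]
  simp [Emod]

open Polynomial in
/-- `deg Π ≤ 16`. -/
theorem natDegree_PiP_le : PiP.natDegree ≤ 16 := by
  refine (natDegree_prod_le univ _).trans ?_
  refine (Finset.sum_le_sum fun i _ => (natDegree_X_add_C (node i)).le).trans ?_
  simp

open Polynomial in
/-- `coeff_17 Π = 0`. -/
theorem coeff_PiP_17 : PiP.coeff 17 = 0 :=
  coeff_eq_zero_of_natDegree_lt (lt_of_le_of_lt natDegree_PiP_le (by norm_num))

open Polynomial in
/-- Coefficient `n + 1` of `(X + c) · P`. -/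
theorem coeff_X_add_C_mul_succ (c : MvPolynomial (Option (Fin 5)) (ZMod 2))
    (P : Polynomial (MvPolynomial (Option (Fin 5)) (ZMod 2))) (n : ℕ) :
    ((Polynomial.X + Polynomial.C c) * P).coeff (n + 1) = P.coeff n + c * P.coeff (n + 1) := by
  rw [add_mul, Polynomial.coeff_add, Polynomial.coeff_X_mul, Polynomial.coeff_C_mul]

open Polynomial in
/-- `deg f < 26`. -/
theorem natDegree_fP_lt : fP.natDegree < 26 := by
  have h1 : ((Polynomial.X + Polynomial.C (X none)) * PiP :
      Polynomial (MvPolynomial (Option (Fin 5)) (ZMod 2))).natDegree ≤ 17 :=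
    natDegree_mul_le.trans (by
      have := natDegree_X_add_C (X none : MvPolynomial (Option (Fin 5)) (ZMod 2))
      have := natDegree_PiP_le
      omega)
  have h2 := (natDegree_mul_le (p := (Polynomial.X ^ 8 : Polynomial (MvPolynomial (Option (Fin 5)) (ZMod 2))))
    (q := (Polynomial.X + Polynomial.C (X none)) * PiP))
  have h3 := natDegree_X_pow_le (R := MvPolynomial (Option (Fin 5)) (ZMod 2)) 8
  rw [fP]
  omega

open Polynomial in
/-- The coefficients of `f` below `X^8` vanish. -/
theorem coeff_fP_lt_eight {d : ℕ} (hd : d < 8) : fP.coeff d = 0 := by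
  rw [fP, coeff_X_pow_mul', if_neg (by omega)]

open Polynomial in
/-- Coefficients of `f` above `X^8`. -/
theorem coeff_fP_shift (t : ℕ) : fP.coeff (8 + t) = ((Polynomial.X + Polynomial.C (X none)) * PiP).coeff t := by
  rw [fP, coeff_X_pow_mul', if_pos (by omega), Nat.add_sub_cancel_left]

open Polynomial in
/-- `coeff_23 f = e₂ + Y₀ e₁ = 0`. -/
theorem coeff_fP_23 : fP.coeff 23 = 0 := by
  rw [show (23 : ℕ) = 8 + (14 + 1) from rfl, coeff_fP_shift, coeff_X_add_C_mul_succ,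
    coeff_PiP (by norm_num), coeff_PiP (by norm_num)]
  norm_num
  rw [Emod_two, Emod_one]
  linear_combination (X none * sbar) * two_eq_zero_R2

open Polynomial in
/-- `coeff_22 f = e₃ + Y₀ e₂ = 0`. -/
theorem coeff_fP_22 : fP.coeff 22 = 0 := by
  rw [show (22 : ℕ) = 8 + (13 + 1) from rfl, coeff_fP_shift, coeff_X_add_C_mul_succ,
    coeff_PiP (by norm_num), coeff_PiP (by norm_num)]
  norm_num
  rw [Emod_three, Emod_two]
  linear_combination (X none ^ 2 * sbar) * two_eq_zero_R2

open Polynomial in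
/-- The leading coefficient: `coeff_25 f = 1`. -/
theorem coeff_fP_25 : fP.coeff 25 = 1 := by
  rw [show (25 : ℕ) = 8 + (16 + 1) from rfl, coeff_fP_shift, coeff_X_add_C_mul_succ,
    coeff_PiP (by norm_num), coeff_PiP_17]
  norm_num
  exact Emod_zero

open Polynomial in
/-- Every node is a root of `f` (characteristic `2`: the factor `X + η_i` vanishes at `η_i`). -/
theorem eval_fP_node (i : Fin 16) : fP.eval (node i) = 0 := by
  rw [fP, Polynomial.eval_mul, Polynomial.eval_mul, PiP, Polynomial.eval_prod]
  have : (∏ j : Fin 16, (Polynomial.X + Polynomial.C (node j)).eval (node i)) = 0 := by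
    apply Finset.prod_eq_zero (Finset.mem_univ i)
    rw [Polynomial.eval_add, Polynomial.eval_X, Polynomial.eval_C, ← two_mul, two_eq_zero_R2, zero_mul]
  rw [this, mul_zero, mul_zero]

/-- Off the sixteen column weights (and below `26`) the coefficients of `f` vanish. -/
theorem coeff_fP_eq_zero_of_not_mem {d : ℕ} (hd : d < 26) (hn : d ∉ (univ : Finset (Fin 16)).image wt52) :
    fP.coeff d = 0 := by
  interval_cases d <;>
    first
    | exact coeff_fP_lt_eight (by decide)
    | exact coeff_fP_22
    | exact coeff_fP_23
    | exact (hn (by decide)).elim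

/-- **The null vector**: `Σ_j η_i^{w_j} · coeff_{w_j}(f) = f(η_i) = 0` for every row `i`. -/
theorem frobMatrix52_mulVec_eq_zero :
    (Matrix.of fun i j : Fin 16 => node i ^ wt52 j) *ᵥ (fun j => fP.coeff (wt52 j)) = 0 := by
  funext i
  rw [Matrix.mulVec, Pi.zero_apply]
  change ∑ j, node i ^ wt52 j * fP.coeff (wt52 j) = 0
  have hev := eval_fP_node i
  rw [Polynomial.eval_eq_sum_range' natDegree_fP_lt] at hev
  -- restrict the range sum to the image of `wt52`
  have hsub : (univ : Finset (Fin 16)).image wt52 ⊆ Finset.range 26 := by decide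
  rw [← Finset.sum_subset hsub (fun d hd hn => by
      rw [coeff_fP_eq_zero_of_not_mem (Finset.mem_range.mp hd) hn, zero_mul]),
    Finset.sum_image (fun j _ j' _ h => (show Function.Injective wt52 by decide) h)] at hev
  simpa [mul_comm] using hev

/-- **The characteristic-2 generalized Vandermonde of the witness layout is singular.** -/
theorem det_frobMatrix52_eq_zero : (Matrix.of fun i j : Fin 16 => node i ^ wt52 j).det = 0 := by
  refine Matrix.exists_mulVec_eq_zero_iff.mp ⟨fun j => fP.coeff (wt52 j), ?_, frobMatrix52_mulVec_eq_zero⟩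
  intro h0
  have := congrFun h0 15
  simp only [Pi.zero_apply] at this
  have h25 : wt52 15 = 25 := by decide
  rw [h25, coeff_fP_25] at this
  exact one_ne_zero this

/-! ## 6. The negation -/

/-- **`MooreBallNonsingular 5 2` is false**: the characteristic-2 Moore table is not universal for the Hamming
ball `B([5], 2)` (witness columns of binary weights `8,…,21,24,25`; kit census j281989 lists all 358 failures). -/
theorem not_mooreBallNonsingular_five_two : ¬ MooreBallNonsingular 5 2 := by
  intro hF
  apply hF 16 rows52 cols52 (by decide) (by decide) (by decide) (by decide)
  have hmat : (Matrix.of fun i j : Fin 16 =>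
      ((X none + ∑ a ∈ rows52 i, X (some a) : MvPolynomial (Option (Fin 5)) (ZMod 2))) ^
        (∑ c ∈ cols52 j, 2 ^ (c : ℕ))) = Matrix.of fun i j : Fin 16 => node i ^ wt52 j := by
    refine Matrix.ext fun i j => ?_
    rw [Matrix.of_apply, Matrix.of_apply, cols52_wt]
    rfl
  rw [hmat]
  exact det_frobMatrix52_eq_zero

end

end Summit.ValiantsHypothesis.ValiantsHypothesis.Theorems.BarrierLever.FrobeniusDoor
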